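import Literature.IUT.LogVolume.DHProbabilisticSzpiroTerms
import Literature.IUT.LogVolume.PilotDataBaseChange
import HarnessLib

/-!
# Dupuy–Hilado (arXiv:2004.13108v2) §7.9 (7.12), §7.10 (7.14), §7.5 (7.5): the term `IV_p` EVALUATED —
# the printed bound (7.12) holds in the REVERSE direction — `V_p` bounded, and the five-term bound CORRECTED

PROOF-ONLY sequel of `DHProbabilisticSzpiroTerms` over the typed candidates of `DHProbabilisticSzpiro`
(T. Dupuy, A. Hilado, arXiv:2004.13108v2 [DupuyHilado2020], held render `book:anonnd-2004-13108v2`, locators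
`p.N l.M`). What is PROVED, for every prime `p`, every pilot datum `X` and section datum `R`:

* §7.9 p.26 l.54–66: the EXACT value `IV_p = ln(b_p)·(2/(l−1)) Σ_{j=1}^{(l−1)/2} (j+1)(1 − P_{unr,p}^{j+1})`
  (`termIV_eq`), and the averaging inequality the printed step uses,
  `(2/(l−1)) Σ_j (j+1)(1 − P^{j+1}) ≤ ((l+5)/4)(1 − P^{(l+1)/2})` (`avg712_le`).
* **(7.12) p.26 l.46–53, "`IV_p ≤ ((l+5)/4) ln(b_p)(1 − P_{unr,p}^{(l+1)/2})`", holds in the REVERSE direction**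
  (`rhs712_le_termIV`): `ln(b_p) = −1 − ln ln p < 0` for every prime (`log_bConst_neg`), so multiplying
  `avg712_le` by `ln(b_p)` (p.26 l.57–72) reverses it. Consequently the typed-as-printed candidate `BoundIV`
  FAILS whenever `0 < P_{unr,p} < 1` (`not_boundIV`; the averaging inequality is strict at `j = 1` since
  `ℓ⋆ ≥ 2`). What the argument supports: `IV_p ≤ ((l+5)/4)·ln(b_p)·(1 − P_{unr,p}²)` (`termIV_le_corrected`)
  and `IV_p ≤ 0` (`termIV_nonpos`). A print-level slip in an UNREFEREED preprint's bookkeeping — recorded as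
  a kernel fact about the displayed real inequality, nothing more; the affected constant is the summand
  `(1 − P^{(l+1)/2}_{unr,p})·ln(b_p)` of `A_{l,V}` in Thm 7.12.1 / Thm 1.0.3 (`archConst`).
* **(7.14)** p.27 l.1–21: `V_p ≤ ((l+5)/4)·ln(e_p)` (`boundV_holds`; Jensen for `ln` + independence), discharging
  the candidate `BoundV`.
* **(7.5) p.23 l.47–51, CORRECTED** (`radiusLn_le_pointwise`, `E2_radiusLn_le`): reading Lemma 6.3.1 (p.21
  l.75 – p.22 l.21, `radiusLn`) line by line, given the printed proof's own input "`v⃗` unramified ⇒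
  `a_{j,v_j} = 1`" (p.22 l.24; here `hNOS`: the chosen place over a bad place is ramified), one gets at every
  tuple `ln R_v⃗ ≤ −ord_p(a)·ln p + ord_p(β)·ln p + ln(p)·1_ram + (j+1)ln(b_p)·1_gen + Σ_i ln e(v_i/p)` —
  dropping the floor `⌊ord_p(a) − ord_p(β)⌋` costs `ln(p)·1_ram(v⃗)` (print's `III_p` carries `1·1_ram`), and
  the credit `(j+1) ln(b_p) < 0` is available on GENERAL tuples only (third line of Lemma 6.3.1), not on
  small ramified ones as print's `IV_p` has it. Averaged: `E²_p(ln R_v⃗) ≤ I_p + II_p + ln(p)·III_p + V_p`.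

HONEST FRAMING: elementary real-analysis facts about the typed displays; nothing here asserts, uses or bears
on the disputed [IUTchIII] Cor. 3.12 [claim: Mochizuki2012, status: disputed] or Claim 5.0.1, which enter the
paper only through (7.3)/(7.4) (typed hypotheses `TautologicalProbabilisticIneq` / `Ineq74`, never asserted).
Whether the printed Thm 1.0.3 holds is not addressed: only what its printed derivation yields
(`DHProbabilisticSzpiroCorrected`). Typed ≠ proved ≠ endorsed; no side is taken on any author.
-/

noncomputable section

namespace Literature.IUT.LogVolume

open NumberField IsDedekindDomain Finset

namespace ExplicitSzpiro

variable {F₀ : Type*} [Field F₀] [NumberField F₀] (X : PilotData F₀) (R : SectionRamification F₀)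

/-! ## §4 (7.12): the exact value of `IV_p`; the printed bound holds in the REVERSE direction -/

/-- "`E((j+1) ln(b_p) 1_ram(v⃗)) = (j+1) ln(b_p)(1 − P_{unr,p}^{j+1})`" (p.26 l.54–56) PROVED for prime `p`.
[cite: DupuyHilado2020, §7.9 p.26 l.54–56] -/
theorem sum_tuple_termIV (p : ℕ) [Fact p.Prime] (j : ℕ) :
    ∑ e : Fin (j + 1) → placesOver F₀ p,
        ((j : ℝ) + 1) * Real.log (bConst p) * R.indRam e * ∏ k, weight F₀ (e k).1 =
      ((j : ℝ) + 1) * Real.log (bConst p) * (1 - R.probUnram p ^ (j + 1)) := by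
  rw [← sum_tuple_indRam R p j, Finset.mul_sum]
  exact Finset.sum_congr rfl fun e _ => by ring

/-- **(7.12), exact form** PROVED for prime `p`:
`IV_p = ln(b_p)·(2/(l−1)) Σ_{j=1}^{(l−1)/2} (j+1)(1 − P_{unr,p}^{j+1})` (p.26 l.57–66; index `i : Fin ℓ⋆` is
`j = i+1`). [cite: DupuyHilado2020, §7.9 p.26 l.57–66] -/
theorem termIV_eq (p : ℕ) [Fact p.Prime] :
    termIV X R p = Real.log (bConst p) * ((1 / (X.lstar : ℝ)) *
      ∑ i : Fin X.lstar, ((((i : ℕ) : ℝ) + 1) + 1) * (1 - R.probUnram p ^ ((i : ℕ) + 1 + 1))) := by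
  have h : ∀ i : Fin X.lstar, ∑ e : Fin ((i : ℕ) + 1 + 1) → placesOver F₀ p,
      ((((i : ℕ) + 1 : ℕ) : ℝ) + 1) * Real.log (bConst p) * R.indRam e * ∏ k, weight F₀ (e k).1 =
        Real.log (bConst p) * (((((i : ℕ) : ℝ) + 1) + 1) * (1 - R.probUnram p ^ ((i : ℕ) + 1 + 1))) := by
    intro i
    rw [sum_tuple_termIV R p ((i : ℕ) + 1)]
    push_cast
    ring
  unfold termIV E2
  rw [Finset.sum_congr rfl fun i _ => h i, ← Finset.mul_sum]
  ring

/-- The averaging inequality the printed step uses: for `0 ≤ P ≤ 1`,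
`(2/(l−1)) Σ_j (j+1)(1 − P^{j+1}) ≤ ((l+5)/4)·(1 − P^{(l+1)/2})` (each `1 − P^{j+1} ≤ 1 − P^{(l+1)/2}` and
`(2/(l−1)) Σ_{j=1}^{(l−1)/2} (j+1) = (l+5)/4`). [cite: DupuyHilado2020, §7.9 p.26 l.57–72] -/
theorem avg712_le (p : ℕ) [Fact p.Prime] :
    (1 / (X.lstar : ℝ)) * ∑ i : Fin X.lstar, ((((i : ℕ) : ℝ) + 1) + 1) * (1 - R.probUnram p ^ ((i : ℕ) + 1 + 1))
      ≤ (((2 * (X.lstar : ℝ) + 1) + 5) / 4) * (1 - R.probUnram p ^ (X.lstar + 1)) := by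
  have hl2 := X.two_le_lstar
  have hl : (X.lstar : ℝ) ≠ 0 := by exact_mod_cast (by omega : X.lstar ≠ 0)
  have hP0 := probUnram_nonneg R p
  have hP1 := probUnram_le_one R p
  have hterm : ∀ i : Fin X.lstar,
      ((((i : ℕ) : ℝ) + 1) + 1) * (1 - R.probUnram p ^ ((i : ℕ) + 1 + 1)) ≤
        ((((i : ℕ) : ℝ) + 1) + 1) * (1 - R.probUnram p ^ (X.lstar + 1)) := by
    intro i
    have hi := i.2
    have : R.probUnram p ^ (X.lstar + 1) ≤ R.probUnram p ^ ((i : ℕ) + 1 + 1) :=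
      pow_le_pow_of_le_one hP0 hP1 (by omega)
    exact mul_le_mul_of_nonneg_left (by linarith) (by positivity)
  calc (1 / (X.lstar : ℝ)) * ∑ i : Fin X.lstar, ((((i : ℕ) : ℝ) + 1) + 1) * (1 - R.probUnram p ^ ((i : ℕ) + 1 + 1))
      ≤ (1 / (X.lstar : ℝ)) * ∑ i : Fin X.lstar, ((((i : ℕ) : ℝ) + 1) + 1) * (1 - R.probUnram p ^ (X.lstar + 1)) :=
        mul_le_mul_of_nonneg_left (Finset.sum_le_sum fun i _ => hterm i) (by positivity)
    _ = (((2 * (X.lstar : ℝ) + 1) + 5) / 4) * (1 - R.probUnram p ^ (X.lstar + 1)) := by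
        rw [← Finset.sum_mul, sum_fin_add_two]
        field_simp
        ring

/-- **The printed (7.12) holds in the REVERSE direction** (every prime `p`, every datum):
`((l+5)/4)·ln(b_p)·(1 − P_{unr,p}^{(l+1)/2}) ≤ IV_p` — `ln(b_p) < 0` (`log_bConst_neg`) reverses the
averaging inequality `avg712_le` that the printed step (p.26 l.57–72) multiplies by `ln(b_p)`.
[cite: DupuyHilado2020, (7.12) p.26 l.46–72] -/
theorem rhs712_le_termIV (p : ℕ) [hp : Fact p.Prime] :
    (((2 * (X.lstar : ℝ) + 1) + 5) / 4) * Real.log (bConst p) * (1 - R.probUnram p ^ (X.lstar + 1))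
      ≤ termIV X R p := by
  rw [termIV_eq, mul_comm (_ / 4) (Real.log _), mul_assoc]
  exact mul_le_mul_of_nonpos_left (avg712_le X R p) (log_bConst_neg p hp.out).le

/-- **`BoundIV` — (7.12) as printed — FAILS** whenever `0 < P_{unr,p} < 1` (prime `p`; `ℓ⋆ ≥ 2` since
`l ≥ 5`): the averaging inequality is then strict at `j = 1` and `ln(b_p) < 0`, so
`IV_p > ((l+5)/4)·ln(b_p)·(1 − P_{unr,p}^{(l+1)/2})`. [cite: DupuyHilado2020, (7.12) p.26 l.46–72] -/
theorem not_boundIV (p : ℕ) [hp : Fact p.Prime] (h0 : 0 < R.probUnram p) (h1 : R.probUnram p < 1) :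
    ¬ BoundIV X R p := by
  have hl2 := X.two_le_lstar
  have hl : (X.lstar : ℝ) ≠ 0 := by exact_mod_cast (by omega : X.lstar ≠ 0)
  have hP0 := probUnram_nonneg R p
  have hP1 := probUnram_le_one R p
  have hlt : ∑ i : Fin X.lstar, ((((i : ℕ) : ℝ) + 1) + 1) * (1 - R.probUnram p ^ ((i : ℕ) + 1 + 1)) <
      ∑ i : Fin X.lstar, ((((i : ℕ) : ℝ) + 1) + 1) * (1 - R.probUnram p ^ (X.lstar + 1)) := by
    refine Finset.sum_lt_sum (fun i _ => ?_) ⟨⟨0, by omega⟩, Finset.mem_univ _, ?_⟩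
    · have hi := i.2
      have : R.probUnram p ^ (X.lstar + 1) ≤ R.probUnram p ^ ((i : ℕ) + 1 + 1) :=
        pow_le_pow_of_le_one hP0 hP1 (by omega)
      exact mul_le_mul_of_nonneg_left (by linarith) (by positivity)
    · have : R.probUnram p ^ (X.lstar + 1) < R.probUnram p ^ (0 + 1 + 1) :=
        pow_lt_pow_right_of_lt_one₀ h0 h1 (by omega)
      simp only [Nat.cast_zero]
      exact mul_lt_mul_of_pos_left (by linarith) (by norm_num)
  have hstrict : (1 / (X.lstar : ℝ)) *
        ∑ i : Fin X.lstar, ((((i : ℕ) : ℝ) + 1) + 1) * (1 - R.probUnram p ^ ((i : ℕ) + 1 + 1))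
      < (((2 * (X.lstar : ℝ) + 1) + 5) / 4) * (1 - R.probUnram p ^ (X.lstar + 1)) := by
    calc (1 / (X.lstar : ℝ)) *
          ∑ i : Fin X.lstar, ((((i : ℕ) : ℝ) + 1) + 1) * (1 - R.probUnram p ^ ((i : ℕ) + 1 + 1))
        < (1 / (X.lstar : ℝ)) *
          ∑ i : Fin X.lstar, ((((i : ℕ) : ℝ) + 1) + 1) * (1 - R.probUnram p ^ (X.lstar + 1)) :=
          mul_lt_mul_of_pos_left hlt (by positivity)
      _ = (((2 * (X.lstar : ℝ) + 1) + 5) / 4) * (1 - R.probUnram p ^ (X.lstar + 1)) := by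
          rw [← Finset.sum_mul, sum_fin_add_two]
          field_simp
          ring
  intro hIV
  unfold BoundIV at hIV
  rw [termIV_eq] at hIV
  have := mul_lt_mul_of_neg_left hstrict (log_bConst_neg p hp.out)
  linarith

/-- **Corrected (7.12)** PROVED (prime `p`): `IV_p ≤ ((l+5)/4)·ln(b_p)·(1 − P_{unr,p}²)` — what the printed
argument supports once the sign of `ln(b_p)` is taken into account (`1 − P^{j+1} ≥ 1 − P²` for `j ≥ 1`).
[cite: DupuyHilado2020, (7.12) p.26 l.46–72] -/
theorem termIV_le_corrected (p : ℕ) [hp : Fact p.Prime] :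
    termIV X R p ≤ (((2 * (X.lstar : ℝ) + 1) + 5) / 4) * Real.log (bConst p) * (1 - R.probUnram p ^ 2) := by
  have hl2 := X.two_le_lstar
  have hl : (X.lstar : ℝ) ≠ 0 := by exact_mod_cast (by omega : X.lstar ≠ 0)
  have hP0 := probUnram_nonneg R p
  have hP1 := probUnram_le_one R p
  have hge : (((2 * (X.lstar : ℝ) + 1) + 5) / 4) * (1 - R.probUnram p ^ 2) ≤
      (1 / (X.lstar : ℝ)) *
        ∑ i : Fin X.lstar, ((((i : ℕ) : ℝ) + 1) + 1) * (1 - R.probUnram p ^ ((i : ℕ) + 1 + 1)) := by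
    have hterm : ∀ i : Fin X.lstar, ((((i : ℕ) : ℝ) + 1) + 1) * (1 - R.probUnram p ^ 2) ≤
        ((((i : ℕ) : ℝ) + 1) + 1) * (1 - R.probUnram p ^ ((i : ℕ) + 1 + 1)) := by
      intro i
      have : R.probUnram p ^ ((i : ℕ) + 1 + 1) ≤ R.probUnram p ^ 2 :=
        pow_le_pow_of_le_one hP0 hP1 (by omega)
      exact mul_le_mul_of_nonneg_left (by linarith) (by positivity)
    calc (((2 * (X.lstar : ℝ) + 1) + 5) / 4) * (1 - R.probUnram p ^ 2)
        = (1 / (X.lstar : ℝ)) * ∑ i : Fin X.lstar, ((((i : ℕ) : ℝ) + 1) + 1) * (1 - R.probUnram p ^ 2) := by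
          rw [← Finset.sum_mul, sum_fin_add_two]
          field_simp
          ring
      _ ≤ _ := mul_le_mul_of_nonneg_left (Finset.sum_le_sum fun i _ => hterm i) (by positivity)
  rw [termIV_eq, mul_comm (_ / 4) (Real.log _), mul_assoc]
  exact mul_le_mul_of_nonpos_left hge (log_bConst_neg p hp.out).le

/-- `IV_p ≤ 0` (prime `p`): `ln(b_p) < 0` times a nonnegative average. [cite: DupuyHilado2020, (7.12) p.26 l.46–72] -/
theorem termIV_nonpos (p : ℕ) [hp : Fact p.Prime] : termIV X R p ≤ 0 := by
  have hP0 := probUnram_nonneg R p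
  have hP1 := probUnram_le_one R p
  have havg : 0 ≤ (1 / (X.lstar : ℝ)) *
      ∑ i : Fin X.lstar, ((((i : ℕ) : ℝ) + 1) + 1) * (1 - R.probUnram p ^ ((i : ℕ) + 1 + 1)) := by
    refine mul_nonneg (by positivity) (Finset.sum_nonneg fun i _ => mul_nonneg (by positivity) ?_)
    have : R.probUnram p ^ ((i : ℕ) + 1 + 1) ≤ 1 := pow_le_one₀ hP0 hP1
    linarith
  rw [termIV_eq]
  have hneg := (log_bConst_neg p hp.out).le
  nlinarith

/-! ## §5 (7.14): the bound on `V_p` -/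

/-- Jensen step of §7.10: `E(ln e(v/p)) ≤ ln E(e(v/p)) = ln(e_p)` (prime `p`). [cite: DupuyHilado2020, §7.10 p.27 l.1–18] -/
theorem expect_log_ramIdx_le (p : ℕ) [Fact p.Prime] :
    ∑ v ∈ placesOver F₀ p, Real.log (R.e v : ℝ) * weight F₀ v ≤ Real.log (R.avgRamIdx p) := by
  unfold SectionRamification.avgRamIdx
  exact jensen_log _ (weight F₀) (fun v => (R.e v : ℝ)) (fun v _ => weight_nonneg F₀ v) (sum_weight p)
    fun v _ => by exact_mod_cast R.one_le_e v

/-- **(7.14)** PROVED for prime `p`: `V_p ≤ ((l+5)/4)·ln(e_p)` (the typed candidate `BoundV`, discharged; printed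
with the label `IV_p` at p.27 l.20, meaning `V_p`). [cite: DupuyHilado2020, (7.14) p.27 l.1–21] -/
theorem boundV_holds (p : ℕ) [Fact p.Prime] : BoundV X R p := by
  have hl2 := X.two_le_lstar
  have hl : (X.lstar : ℝ) ≠ 0 := by exact_mod_cast (by omega : X.lstar ≠ 0)
  have h : ∀ i : Fin X.lstar, ∑ e : Fin ((i : ℕ) + 1 + 1) → placesOver F₀ p,
      (∑ k, Real.log (R.e (e k).1 : ℝ)) * ∏ k, weight F₀ (e k).1 ≤
        ((((i : ℕ) : ℝ) + 1) + 1) * Real.log (R.avgRamIdx p) := by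
    intro i
    rw [sum_tuple_sum_coord p ((i : ℕ) + 1) (fun v => Real.log (R.e v : ℝ))]
    push_cast
    exact mul_le_mul_of_nonneg_left (expect_log_ramIdx_le R p) (by positivity)
  unfold BoundV termV E2
  calc (1 / (X.lstar : ℝ)) * ∑ i : Fin X.lstar, ∑ e : Fin ((i : ℕ) + 1 + 1) → placesOver F₀ p,
          (∑ k, Real.log (R.e (e k).1 : ℝ)) * ∏ k, weight F₀ (e k).1
      ≤ (1 / (X.lstar : ℝ)) * ∑ i : Fin X.lstar, ((((i : ℕ) : ℝ) + 1) + 1) * Real.log (R.avgRamIdx p) :=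
        mul_le_mul_of_nonneg_left (Finset.sum_le_sum fun i _ => h i) (by positivity)
    _ = (((2 * (X.lstar : ℝ) + 1) + 5) / 4) * Real.log (R.avgRamIdx p) := by
        rw [← Finset.sum_mul, sum_fin_add_two]
        field_simp
        ring


/-! ## §6 (7.5) corrected: the pointwise bound behind the five terms, and the averaged four-term bound -/

/-- `ord_p(a_{j,v}) ≥ 0` (coefficients of `P_q` are `ord_v(q_v)/2l ≥ 0`, `PilotData.qPilot_apply`).
[cite: DupuyHilado2020, §6.3 p.21 l.56–62] -/
theorem ordpA_nonneg (j : ℕ) (v : HeightOneSpectrum (𝓞 F₀)) : 0 ≤ ordpA X j v := by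
  unfold ordpA
  have hq : 0 ≤ X.qPilot v := by
    rw [PilotData.qPilot_apply]
    split_ifs with hv
    · have h1 := X.ordq_pos hv
      have h2 := X.two_mul_l_pos
      positivity
    · exact le_rfl
  positivity

/-- `ord_p(β_v⃗) = ‖diff‖₁ − ‖diff‖∞ ≥ 0`. [cite: DupuyHilado2020, §6.2 p.20 l.55–59] -/
theorem ordβ_nonneg {p j : ℕ} (e : Fin (j + 1) → placesOver F₀ p) : 0 ≤ R.ordβ e := by
  unfold SectionRamification.ordβ
  obtain ⟨i, -, hi⟩ := Finset.exists_mem_eq_sup' Finset.univ_nonempty (fun i => R.diff (e i).1)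
  rw [hi, sub_nonneg]
  exact Finset.single_le_sum (fun k _ => R.diff_nonneg (e k).1) (Finset.mem_univ i)

/-- **The pointwise bound behind (7.5), CORRECTED.** At every tuple `v⃗ = (v_0,…,v_j)` over `p`, given the
printed proof's own input "`v⃗` unramified ⇒ `a_{j,v_j} = 1`" (p.22 l.24; here: the chosen place over a bad
place is ramified, `hNOS`), the explicit log-radius of Lemma 6.3.1 satisfies
`ln R_v⃗ ≤ −ord_p(a_{j,v_j})·ln p + ord_p(β_v⃗)·ln p + ln(p)·1_ram(v⃗) + (j+1)·ln(b_p)·1_gen(v⃗) + Σ_i ln e(v_i/p)`,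
where `1_gen` is the indicator of the THIRD line of Lemma 6.3.1 (neither unramified nor small). The floor
costs `ln(p)·1_ram`, not `1·1_ram` (`⌊y⌋ > y − 1`), and the `ln(b_p)`-credit is earned on general tuples only.
[cite: DupuyHilado2020, Lemma 6.3.1 p.21 l.75 – p.22 l.26; (7.5) p.23 l.47 – p.24 l.27] -/
theorem radiusLn_le_pointwise (p : ℕ) (hNOS : ∀ v ∈ X.S, R.e v ≠ 1) (j : ℕ)
    (e : Fin (j + 1) → placesOver F₀ p) :
    radiusLn X R p j e ≤
      -(ordpA X j (e (Fin.last j)).1 * Real.log p) + R.ordβ e * Real.log p + Real.log p * R.indRam e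
        + ((j : ℝ) + 1) * Real.log (bConst p) *
            (if R.IsUnramifiedTuple e then 0 else if R.IsSmallTuple e then 0 else 1)
        + ∑ i, Real.log (R.e (e i).1 : ℝ) := by
  have hlog : 0 ≤ Real.log p := Real.log_natCast_nonneg p
  have hβ := ordβ_nonneg R e
  have hsumlog : 0 ≤ ∑ i, Real.log (R.e (e i).1 : ℝ) :=
    Finset.sum_nonneg fun i _ => Real.log_nonneg (by exact_mod_cast R.one_le_e (e i).1)
  have hfloor : -(⌊ordpA X j (e (Fin.last j)).1 - R.ordβ e⌋ : ℝ) * Real.log p ≤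
      -(ordpA X j (e (Fin.last j)).1 * Real.log p) + R.ordβ e * Real.log p + Real.log p := by
    have h1 := Int.sub_one_lt_floor (ordpA X j (e (Fin.last j)).1 - R.ordβ e)
    nlinarith
  unfold radiusLn
  by_cases hu : R.IsUnramifiedTuple e
  · -- line 1 of Lemma 6.3.1: `ln R = 0`; here `a_{j,v_j} = 1`, `1_ram = 0`, all `e(v_i/p) = 1`
    have hA : ordpA X j (e (Fin.last j)).1 = 0 := by
      have hv : (e (Fin.last j)).1 ∉ X.S := fun hS => hNOS _ hS (hu (Fin.last j))
      simp [ordpA, PilotData.qPilot_apply, hv]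
    have hram : R.indRam e = 0 := by simp [SectionRamification.indRam, hu]
    rw [if_pos hu, if_pos hu, hA, hram]
    nlinarith
  · have hram : R.indRam e = 1 := by simp [SectionRamification.indRam, hu]
    rw [if_neg hu, if_neg hu, hram]
    by_cases hs : R.IsSmallTuple e
    · -- line 2: small ramified tuple, no `ln(b_p)`/`ln e` terms in `ln R`
      rw [if_pos hs, if_pos hs]
      nlinarith
    · -- line 3: general tuple
      rw [if_neg hs, if_neg hs]
      nlinarith

/-- **(7.5) CORRECTED and PROVED** (every prime `p`, given `bad ⇒ ramified`):
`E²_p(ln R_v⃗) ≤ I_p + II_p + ln(p)·III_p + V_p` — the `ln(b_p)`-credit `IV` (nonpositive, and in print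
credited also at small tuples where Lemma 6.3.1 does not grant it) is dropped, and `III_p` carries the
factor `ln(p)` that dropping the floor of Lemma 6.3.1 costs. [cite: DupuyHilado2020, (7.5) p.23 l.47 – p.24 l.27] -/
theorem E2_radiusLn_le (p : ℕ) [hp : Fact p.Prime] (hNOS : ∀ v ∈ X.S, R.e v ≠ 1) :
    E2 p X.lstar (radiusLn X R p) ≤
      termI X p + termII X R p + Real.log p * termIII X R p + termV X R p := by
  have hb := (log_bConst_neg p hp.out).le
  have hpt : ∀ (j : ℕ) (e : Fin (j + 1) → placesOver F₀ p), radiusLn X R p j e ≤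
      -(ordpA X j (e (Fin.last j)).1 * Real.log p) + R.ordβ e * Real.log p
        + Real.log p * R.indRam e + ∑ i, Real.log (R.e (e i).1 : ℝ) := by
    intro j e
    have h := radiusLn_le_pointwise X R p hNOS j e
    have hcredit : ((j : ℝ) + 1) * Real.log (bConst p) *
        (if R.IsUnramifiedTuple e then 0 else if R.IsSmallTuple e then 0 else 1) ≤ 0 := by
      split_ifs
      · simp
      · simp
      · rw [mul_one]; exact mul_nonpos_of_nonneg_of_nonpos (by positivity) hb
    linarith
  calc E2 p X.lstar (radiusLn X R p)
      ≤ E2 p X.lstar (fun j e => -(ordpA X j (e (Fin.last j)).1 * Real.log p) + R.ordβ e * Real.log p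
          + Real.log p * R.indRam e + ∑ i, Real.log (R.e (e i).1 : ℝ)) := E2_mono p _ hpt
    _ = termI X p + termII X R p + Real.log p * termIII X R p + termV X R p := by
        rw [E2_add, E2_add, E2_add, E2_const_mul, E2_neg]
        rfl


end ExplicitSzpiro

end Literature.IUT.LogVolume

end
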